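import Literature.AlgebraicGeometry.Motives.HodgeStructureCentralizerIsotypicBlock
import HarnessLib

/-!
# RESTRICTION TO THE REPRESENTATIVES IS MILNE'S ISOMORPHISM `C(H) ⥲ Π_k C(T_k)`: for an isotypically labelled irreducible
# decomposition `V = ⊕ᵢ Tᵢ` of a `ℚ`-Hodge structure with representatives `T_k`, `k ∈ κ`, every `γ ∈ C(H) = End_{E_φ}(V)`
# preserves each `T_k`, and `γ ↦ (γ|_{T_k})_k` IS an isomorphism of `ℚ`-algebras with involution `C(H) ≃ₐ[ℚ] Π_k C(T_k)` — the
# isomorphism of Milne's Prop. 1.1 in CANONICAL form («which is independent of the choice of the isogeny»: any two maps over the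
# restrictions coincide) (Milne 1999 §1 p. 643 and Prop. 1.1)

[topic AlgebraicGeometry/Motives]

Layer `Literature/AlgebraicGeometry/Motives`, lane `lit-hodgefound` (Track 2 foundations library; prover seat
`lit-hodgefound-p02`, generation 53, self-proposed row g53-#1). THEOREMS ONLY: no definition, no named fact (net debt `0`),
no instance, no notation.  Sequel, BY NAME (nothing restated), of g52-#3 `Motives/HodgeStructureCentralizerInternalBlocks`
(`apply_mem_of_mem_centralizer_endAlg`, `exists_algHom_pi_centralizer`: `C(H) ↪ Π_i C(T_i)` over ALL blocks, with the formula;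
`Polarization.coe_apply_centralizer_adjoint_eq`: any map over the restrictions carries `†` to `Π_k †_k`) and g52-#5
`Motives/HodgeStructureCentralizerIsotypicBlock` (`nonempty_centralizer_endAlg_algEquiv_pi_of_labelling`: SOME
`C(H) ≃ₐ[ℚ] Π_k C(T_k)`, whence the dimension count `finrank_centralizer_endAlg_eq_sum_of_labelling`).  g52-#5 obtained Prop. 1.1
over the representatives as an abstract isomorphism (restriction to the isotypic blocks `W_k ⊇ T_k`, then a transport
`C(W_k) ≃ C(T_k)` along a CHOSEN Hodge isomorphism `T_k^{⊕m_k} ⥲ W_k`); here the isomorphism is identified: it is restriction to the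
representatives themselves, so it depends on nothing but the sub-Hodge structures `T_k` — the internal reading of «independent
of the choice of the isogeny».

## The source, verbatim

J. S. Milne, *Lefschetz classes on abelian varieties*, Duke Math. J. 96 (1999) 639–675 [Milne1999LefschetzClasses] (held
`paper:doi-10-1215-s0012-7094-99-09620-5`, p. 643 L7–L11 and L24–L28): "An isogeny `α : A → B` defines an isomorphism
`γ ↦ V(α) ∘ γ ∘ V(α)⁻¹ : C(A) → C(B)` of `k`-algebras with involution, which is independent of the choice of `α`. Therefore
`C(A)`, as a `k`-algebra with involution, depends only on the isogeny class of `A` (up to a canonical isomorphism). […]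
**Proposition 1.1.** Let `A₁, …, A_s` be a set of representatives for the simple isogeny factors of `A`, so that there exists an
isogeny `A₁^{r₁} × ⋯ × A_s^{r_s} → A` for some `rᵢ > 0`. Any such isogeny induces an isomorphism `C(A₁) × ⋯ × C(A_s) → C(A)` of
`k`-algebras with involution, which is independent of the choice of the isogeny."  Also B. Moonen, *An introduction to
Mumford–Tate groups* (2004) [Moonen2004MT], §4 Lemma 4.6 (block form of a commutant); C. Voisin [VoisinHodgeI2002] §7.3.1
Lemma 7.23 ∕ 7.26 (inverses and projections are morphisms); D. Huybrechts [Huybrechts2016K3] §3.3.5 eq. (3.3) (the adjoint).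

## Dictionary and what is proved (namespace `Literature.AlgebraicGeometry.Motives.HodgeStructure`)

`C(H) = Subalgebra.centralizer ℚ (H.endAlg : Set (Module.End ℚ V))`; for a sub-Hodge structure `A`,
`C(A) = Subalgebra.centralizer ℚ (A.toHodgeStructure.endAlg : Set (Module.End ℚ A.toSubmodule))`; a HODGE RETRACTION onto `A` is a
morphism `p : H → A` with `p|_A = id` (every block of an internal direct sum of sub-Hodge structures has one: the projection;
every sub-Hodge structure of a polarizable `H` has one: the orthogonal projection); `T : ι → SubHodgeStructure H` an internal direct
sum with isotypic labelling `c : ι → κ`, `κ ⊆ ι` (`Tᵢ ≅ T_{c i}`, the `T_k`, `k ∈ κ`, pairwise non-isomorphic); `†` the adjoint of a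
polarization `ψ`, `†_k` that of `ψ|_{T_k}`.  Elements of `C` are written `γ` (Milne), the labelling is `c`.

* §1 (a Hodge retraction `p : H → A`) **`apply_mem_of_mem_centralizer_endAlg_of_retraction`** (`γ A ⊆ A`),
  **`apply_hom_apply_eq_of_mem_centralizer_endAlg_of_retraction`** (`γ (f v) = f (γ v)` for EVERY morphism `f : A → H` — `γ`
  commutes with `f ∘ p ∈ E_φ`), **`restrict_mem_centralizer_endAlg_of_retraction`** (`γ|_A ∈ C(A)`); for polarizable `H` every
  sub-Hodge structure qualifies: `apply_mem_of_mem_centralizer_endAlg_of_isPolarizable`, `apply_hom_apply_eq_of_mem_centralizer_endAlg_of_isPolarizable`.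
* §2 (blocks `Tᵢ` of an internal direct sum) `apply_hom_apply_eq_of_mem_centralizer_endAlg`, **`coe_hom_apply_eq_of_mem_centralizer_endAlg`**
  (`γ ∘ g = g ∘ γ` on `Tᵢ` for every morphism `g : Tᵢ → Tⱼ` — the mechanism behind «`V(α) ∘ γ ∘ V(α)⁻¹`»).
* §3 (labelled decomposition) **`exists_algHom_pi_centralizer_of_labelling`** (restriction to the representatives
  `r : C(H) →ₐ[ℚ] Π_{k ∈ κ} C(T_k)`, `(r γ)_k v = γ v`, is INJECTIVE — `γ|_{Tᵢ} = g ∘ γ|_{T_{c i}} ∘ g⁻¹`; needs only `Tᵢ ≅ T_{c i}`),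
  `centralizer_pi_eq_of_forall_coe_apply_eq` («independent of the choice»: two maps over the restrictions coincide),
  **`exists_algEquiv_pi_centralizer_of_labelling`** (MILNE'S PROP. 1.1, canonical form: restriction to the representatives is an
  isomorphism `C(H) ≃ₐ[ℚ] Π_k C(T_k)` — injective by the above, surjective by the dimension count of g52-#5),
  `coe_symm_apply_eq_of_forall_coe_apply_eq` (the inverse GLUES: `e⁻¹(δ)` is the element of `C(H)` restricting to `δ_k` on `T_k`),
  **`Polarization.exists_algEquiv_pi_centralizer_coe_apply_eq_adjoint_of_labelling`** («of `k`-algebras with involution»: `(e γ†)_k = (e γ)_k^{†_k}`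
  for EVERY polarization `ψ`).
-/

noncomputable section

namespace Literature.AlgebraicGeometry.Motives

namespace HodgeStructure

universe u

variable {V : Type u} [AddCommGroup V] [Module ℚ V] {n : ℤ} {H : HodgeStructure V n}

/-! ## §1 `γ ∈ C(H)` along a Hodge retraction `p : H → A`: `γ A ⊆ A`, `γ ∘ f = f ∘ γ|_A`, `γ|_A ∈ C(A)` -/

section Retraction

variable {A : SubHodgeStructure H} (p : Hom H A.toHodgeStructure)
  (hp : ∀ (v : V) (hv : v ∈ A.toSubmodule), p.toLinearMap v = ⟨v, hv⟩)

include hp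

/-- **`γ ∈ C(H)` preserves every sub-Hodge structure `A` admitting a Hodge retraction `p : H → A`** (`p|_A = id`): the composite
`a = ι_A ∘ p` is a Hodge endomorphism with `a|_A = id`, so `γ v = γ (a v) = a (γ v) ∈ A` for `v ∈ A`.
[cite: Milne1999LefschetzClasses, §1 p. 643] [cite: Moonen2004MT, §4 Lemma 4.6] -/
theorem apply_mem_of_mem_centralizer_endAlg_of_retraction {γ : Module.End ℚ V}
    (hγ : γ ∈ Subalgebra.centralizer ℚ (H.endAlg : Set (Module.End ℚ V))) {v : V} (hv : v ∈ A.toSubmodule) :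
    γ v ∈ A.toSubmodule := by
  have h := LinearMap.congr_fun
    ((Subalgebra.mem_centralizer_iff ℚ).1 hγ _ (Hom.toLinearMap_mem_endAlg (A.subtypeHom.comp p))) v
  simp only [Module.End.mul_apply, Hom.comp_toLinearMap, LinearMap.comp_apply, hp v hv,
    SubHodgeStructure.subtypeHom_toLinearMap, Submodule.subtype_apply] at h
  rw [← h]
  exact (p.toLinearMap (γ v)).2

/-- **`γ ∈ C(H)` commutes with EVERY morphism of Hodge structures `f : A → H` out of a sub-Hodge structure with a Hodge retraction
`p`: `γ (f v) = f (γ v)` for `v ∈ A`** (`f ∘ p ∈ E_φ(H)` commutes with `γ`, and `p v = v`, `p (γ v) = γ v`). This is the mechanism of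
«`γ ↦ V(α) ∘ γ ∘ V(α)⁻¹`»: on an isotypic block `γ` is determined by its restriction to one copy.
[cite: Milne1999LefschetzClasses, §1 p. 643 L7–L8] [cite: VoisinHodgeI2002, §7.3.1 Lemma 7.26] -/
theorem apply_hom_apply_eq_of_mem_centralizer_endAlg_of_retraction {γ : Module.End ℚ V}
    (hγ : γ ∈ Subalgebra.centralizer ℚ (H.endAlg : Set (Module.End ℚ V))) (f : Hom A.toHodgeStructure H)
    (v : A.toSubmodule) :
    γ (f.toLinearMap v) =
      f.toLinearMap ⟨γ v, apply_mem_of_mem_centralizer_endAlg_of_retraction p hp hγ v.2⟩ := by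
  have h := LinearMap.congr_fun
    ((Subalgebra.mem_centralizer_iff ℚ).1 hγ _ (Hom.toLinearMap_mem_endAlg (f.comp p))) (v : V)
  simp only [Module.End.mul_apply, Hom.comp_toLinearMap, LinearMap.comp_apply, hp (v : V) v.2,
    hp (γ v) (apply_mem_of_mem_centralizer_endAlg_of_retraction p hp hγ v.2), Subtype.coe_eta] at h
  exact h.symm

/-- **The restriction `γ|_A` of `γ ∈ C(H)` lies in `C(A)`** for a sub-Hodge structure `A` with a Hodge retraction `p`: a Hodge
endomorphism `b` of `A` gives the morphism `ι_A ∘ b : A → H`, and §1 yields `γ (b v) = b (γ v)`.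
[cite: Milne1999LefschetzClasses, §1 p. 643] [cite: Lange2023AbelianVarietiesComplex, §2.4.4 proof of Cor. 2.4.26 (p. 124)] -/
theorem restrict_mem_centralizer_endAlg_of_retraction {γ : Module.End ℚ V}
    (hγ : γ ∈ Subalgebra.centralizer ℚ (H.endAlg : Set (Module.End ℚ V))) :
    γ.restrict (fun _ hv => apply_mem_of_mem_centralizer_endAlg_of_retraction p hp hγ hv) ∈
      Subalgebra.centralizer ℚ (A.toHodgeStructure.endAlg : Set (Module.End ℚ A.toSubmodule)) := by
  rw [Subalgebra.mem_centralizer_iff]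
  intro b hb
  refine LinearMap.ext fun v => Subtype.ext ?_
  have h := apply_hom_apply_eq_of_mem_centralizer_endAlg_of_retraction p hp hγ
    (A.subtypeHom.comp (endAlg.toHom ⟨b, hb⟩)) v
  simp only [Hom.comp_toLinearMap, LinearMap.comp_apply, SubHodgeStructure.subtypeHom_toLinearMap,
    Submodule.subtype_apply, endAlg.toHom_toLinearMap] at h
  simp only [Module.End.mul_apply, LinearMap.restrict_apply]
  exact h.symm

end Retraction

/-! ### Polarizable `H`: every sub-Hodge structure has a Hodge retraction (the orthogonal projection) -/

section Polarizable

variable [Module.Finite ℚ V]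

/-- **For a polarizable `H`, every `γ ∈ C(H)` preserves EVERY sub-Hodge structure** (the `ψ`-orthogonal projection onto `A` is a
Hodge retraction, Voisin Lemma 7.26 ∕ the tree's `SubHodgeStructure.projectionOntoHom`).
[cite: Milne1999LefschetzClasses, §1 p. 643] [cite: VoisinHodgeI2002, §7.3.1 Lemma 7.26] -/
theorem apply_mem_of_mem_centralizer_endAlg_of_isPolarizable (hH : H.IsPolarizable) (A : SubHodgeStructure H)
    {γ : Module.End ℚ V} (hγ : γ ∈ Subalgebra.centralizer ℚ (H.endAlg : Set (Module.End ℚ V))) {v : V}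
    (hv : v ∈ A.toSubmodule) : γ v ∈ A.toSubmodule := by
  obtain ⟨ψ⟩ := hH
  obtain ⟨B, -, hAB⟩ := A.exists_isCompl_eq_orthogonal ψ
  exact apply_mem_of_mem_centralizer_endAlg_of_retraction (A.projectionOntoHom B hAB)
    (fun w hw => Submodule.projectionOnto_apply_of_mem_left hAB hw) hγ hv

/-- **For a polarizable `H`, `γ ∈ C(H)` commutes with every morphism `f : A → H` out of every sub-Hodge structure `A`**:
`γ (f v) = f (γ v)`. [cite: Milne1999LefschetzClasses, §1 p. 643 L7–L8] [cite: VoisinHodgeI2002, §7.3.1 Lemma 7.26] -/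
theorem apply_hom_apply_eq_of_mem_centralizer_endAlg_of_isPolarizable (hH : H.IsPolarizable) (A : SubHodgeStructure H)
    {γ : Module.End ℚ V} (hγ : γ ∈ Subalgebra.centralizer ℚ (H.endAlg : Set (Module.End ℚ V)))
    (f : Hom A.toHodgeStructure H) (v : A.toSubmodule) :
    γ (f.toLinearMap v) =
      f.toLinearMap ⟨γ v, apply_mem_of_mem_centralizer_endAlg_of_isPolarizable hH A hγ v.2⟩ := by
  obtain ⟨ψ⟩ := id hH
  obtain ⟨B, -, hAB⟩ := A.exists_isCompl_eq_orthogonal ψ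
  exact apply_hom_apply_eq_of_mem_centralizer_endAlg_of_retraction (A.projectionOntoHom B hAB)
    (fun w hw => Submodule.projectionOnto_apply_of_mem_left hAB hw) hγ f v

/-- **For a polarizable `H`, `γ|_A ∈ C(A)` for every sub-Hodge structure `A`.** [cite: Milne1999LefschetzClasses, §1 p. 643]
[cite: VoisinHodgeI2002, §7.3.1 Lemma 7.26] -/
theorem restrict_mem_centralizer_endAlg_of_isPolarizable (hH : H.IsPolarizable) (A : SubHodgeStructure H)
    {γ : Module.End ℚ V} (hγ : γ ∈ Subalgebra.centralizer ℚ (H.endAlg : Set (Module.End ℚ V))) :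
    γ.restrict (fun _ hv => apply_mem_of_mem_centralizer_endAlg_of_isPolarizable hH A hγ hv) ∈
      Subalgebra.centralizer ℚ (A.toHodgeStructure.endAlg : Set (Module.End ℚ A.toSubmodule)) := by
  obtain ⟨ψ⟩ := id hH
  obtain ⟨B, -, hAB⟩ := A.exists_isCompl_eq_orthogonal ψ
  exact restrict_mem_centralizer_endAlg_of_retraction (A.projectionOntoHom B hAB)
    (fun w hw => Submodule.projectionOnto_apply_of_mem_left hAB hw) hγ

end Polarizable

/-! ## §2 Blocks of an internal direct sum: `γ ∘ g = g ∘ γ` for every morphism `g : Tᵢ → Tⱼ` -/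

section Blocks

variable {ι : Type*} [DecidableEq ι] (T : ι → SubHodgeStructure H)
  (hT : DirectSum.IsInternal fun i => (T i).toSubmodule)

include hT

/-- **`γ (f v) = f (γ v)` for `γ ∈ C(H)`, a block `Tᵢ` of an internal direct sum of sub-Hodge structures, and every morphism
`f : Tᵢ → H`** (§1 with the Hodge retraction `πᵢ`). [cite: Milne1999LefschetzClasses, §1 p. 643 L7–L8]
[cite: VoisinHodgeI2002, §7.3.1 Lemma 7.26] -/
theorem apply_hom_apply_eq_of_mem_centralizer_endAlg {γ : Module.End ℚ V}
    (hγ : γ ∈ Subalgebra.centralizer ℚ (H.endAlg : Set (Module.End ℚ V))) (i : ι)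
    (f : Hom (T i).toHodgeStructure H) (v : (T i).toSubmodule) :
    γ (f.toLinearMap v) = f.toLinearMap ⟨γ v, apply_mem_of_mem_centralizer_endAlg T hT hγ i v.2⟩ :=
  apply_hom_apply_eq_of_mem_centralizer_endAlg_of_retraction
    ((SubHodgeStructure.internalProjHom T hT i).codRestrict (T i) (SubHodgeStructure.internalProjHom_apply_mem T hT i))
    (fun _ hw => Subtype.ext (SubHodgeStructure.internalProjHom_apply_of_mem T hT hw)) hγ f v

/-- **«`γ ↦ V(α) ∘ γ ∘ V(α)⁻¹`» internally: `γ ∈ C(H)` COMMUTES with every morphism of Hodge structures `g : Tᵢ → Tⱼ` between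
blocks**, `γ (g v) = g (γ v)` in `V` — so on a block `Tⱼ ≅ Tᵢ` the action of `γ` is the transport of `γ|_{Tᵢ}`.
[cite: Milne1999LefschetzClasses, §1 p. 643 L7–L8 and L12–L13] [cite: Moonen2004MT, §4 Lemma 4.6] -/
theorem coe_hom_apply_eq_of_mem_centralizer_endAlg {γ : Module.End ℚ V}
    (hγ : γ ∈ Subalgebra.centralizer ℚ (H.endAlg : Set (Module.End ℚ V))) {i j : ι}
    (g : Hom (T i).toHodgeStructure (T j).toHodgeStructure) (v : (T i).toSubmodule) :
    γ ((g.toLinearMap v : (T j).toSubmodule) : V) =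
      ((g.toLinearMap ⟨γ v, apply_mem_of_mem_centralizer_endAlg T hT hγ i v.2⟩ : (T j).toSubmodule) : V) := by
  have h := apply_hom_apply_eq_of_mem_centralizer_endAlg T hT hγ i ((T j).subtypeHom.comp g) v
  simpa only [Hom.comp_toLinearMap, LinearMap.comp_apply, SubHodgeStructure.subtypeHom_toLinearMap,
    Submodule.subtype_apply] using h

end Blocks

/-! ## §3 Restriction to the representatives: MILNE'S PROP. 1.1 in canonical form -/

section Any

variable {ι : Type*} {κ : Finset ι} (T : ι → SubHodgeStructure H)

/-- **«independent of the choice of the isogeny»**: two maps `e, e' : C(H) → Π_{k ∈ κ} C(T_k)` both lying over the restrictions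
(`(e γ)_k v = γ v = (e' γ)_k v`) COINCIDE — whatever data (isogeny ∕ decomposition ∕ labelling) was used to build them.
[cite: Milne1999LefschetzClasses, §1 Prop. 1.1 (p. 643)] -/
theorem centralizer_pi_eq_of_forall_coe_apply_eq
    (e e' : Subalgebra.centralizer ℚ (H.endAlg : Set (Module.End ℚ V)) →
      Π k : κ, Subalgebra.centralizer ℚ (((T k).toHodgeStructure).endAlg : Set (Module.End ℚ (T k).toSubmodule)))
    (he : ∀ (γ : Subalgebra.centralizer ℚ (H.endAlg : Set (Module.End ℚ V))) (k : κ) (v : (T k).toSubmodule),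
      ((e γ k : Module.End ℚ (T k).toSubmodule) v : V) = (γ : Module.End ℚ V) v)
    (he' : ∀ (γ : Subalgebra.centralizer ℚ (H.endAlg : Set (Module.End ℚ V))) (k : κ) (v : (T k).toSubmodule),
      ((e' γ k : Module.End ℚ (T k).toSubmodule) v : V) = (γ : Module.End ℚ V) v) :
    e = e' :=
  funext fun γ => funext fun k => Subtype.ext (LinearMap.ext fun v => Subtype.ext ((he γ k v).trans (he' γ k v).symm))

/-- **The inverse GLUES**: for an equivalence `e : C(H) ≃ Π_{k ∈ κ} C(T_k)` lying over the restrictions, `e⁻¹ δ` is the element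
of `C(H)` whose restriction to each representative `T_k` is `δ_k`. [cite: Milne1999LefschetzClasses, §1 Prop. 1.1 (p. 643)] -/
theorem coe_symm_apply_eq_of_forall_coe_apply_eq
    (e : Subalgebra.centralizer ℚ (H.endAlg : Set (Module.End ℚ V)) ≃ₐ[ℚ]
      Π k : κ, Subalgebra.centralizer ℚ (((T k).toHodgeStructure).endAlg : Set (Module.End ℚ (T k).toSubmodule)))
    (he : ∀ (γ : Subalgebra.centralizer ℚ (H.endAlg : Set (Module.End ℚ V))) (k : κ) (v : (T k).toSubmodule),
      ((e γ k : Module.End ℚ (T k).toSubmodule) v : V) = (γ : Module.End ℚ V) v)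
    (δ : Π k : κ, Subalgebra.centralizer ℚ (((T k).toHodgeStructure).endAlg : Set (Module.End ℚ (T k).toSubmodule)))
    (k : κ) (v : (T k).toSubmodule) :
    ((e.symm δ : Subalgebra.centralizer ℚ (H.endAlg : Set (Module.End ℚ V))) : Module.End ℚ V) v =
      ((δ k : Module.End ℚ (T k).toSubmodule) v : V) := by
  rw [← he (e.symm δ) k v, AlgEquiv.apply_symm_apply]

end Any

section Labelled

variable {ι : Type*} [Fintype ι] [DecidableEq ι] (T : ι → SubHodgeStructure H)
  (hT : DirectSum.IsInternal fun i => (T i).toSubmodule) {κ : Finset ι} {c : ι → κ}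
  (hc : ∀ i, ∃ g : Hom (T i).toHodgeStructure (T (c i)).toHodgeStructure, Function.Bijective g.toLinearMap)
  (hκ : ∀ k k' : κ, (∃ g : Hom (T k).toHodgeStructure (T k').toHodgeStructure,
    Function.Bijective g.toLinearMap) → k = k')

include hT hc

/-- **RESTRICTION TO THE REPRESENTATIVES `r : C(H) →ₐ[ℚ] Π_{k ∈ κ} C(T_k)`, `(r γ)_k v = γ v`, is an INJECTIVE homomorphism of
`ℚ`-algebras** as soon as every block `Tᵢ` is isomorphic to its representative `T_{c i}`: if `γ` kills every `T_k`, then for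
`g : Tᵢ ⥲ T_{c i}` and `v ∈ Tᵢ`, `g (γ v) = γ (g v) = 0`, so `γ|_{Tᵢ} = 0` for all `i` and `γ = 0` (`V = ⊕ᵢ Tᵢ`).
[cite: Milne1999LefschetzClasses, §1 p. 643 L7–L13 and Prop. 1.1] [cite: Moonen2004MT, §4 Lemma 4.6] -/
theorem exists_algHom_pi_centralizer_of_labelling :
    ∃ r : Subalgebra.centralizer ℚ (H.endAlg : Set (Module.End ℚ V)) →ₐ[ℚ]
        Π k : κ, Subalgebra.centralizer ℚ (((T k).toHodgeStructure).endAlg : Set (Module.End ℚ (T k).toSubmodule)),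
      (∀ (γ : Subalgebra.centralizer ℚ (H.endAlg : Set (Module.End ℚ V))) (k : κ) (v : (T k).toSubmodule),
        ((r γ k : Module.End ℚ (T k).toSubmodule) v : V) = (γ : Module.End ℚ V) v) ∧
      Function.Injective r := by
  obtain ⟨r₀, hr₀, hinj₀⟩ := exists_algHom_pi_centralizer T hT
  let r : Subalgebra.centralizer ℚ (H.endAlg : Set (Module.End ℚ V)) →ₐ[ℚ]
      Π k : κ, Subalgebra.centralizer ℚ (((T k).toHodgeStructure).endAlg : Set (Module.End ℚ (T k).toSubmodule)) :=
    (AlgHom.pi fun k : κ => Pi.evalAlgHom ℚ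
      (fun i => Subalgebra.centralizer ℚ (((T i).toHodgeStructure).endAlg : Set (Module.End ℚ (T i).toSubmodule)))
        (k : ι)).comp r₀
  have hr : ∀ (γ : Subalgebra.centralizer ℚ (H.endAlg : Set (Module.End ℚ V))) (k : κ) (v : (T k).toSubmodule),
      ((r γ k : Module.End ℚ (T k).toSubmodule) v : V) = (γ : Module.End ℚ V) v := fun γ k v => hr₀ γ k v
  refine ⟨r, hr, (injective_iff_map_eq_zero r).2 fun γ hγ => ?_⟩
  -- `γ` kills every representative
  have hzero : ∀ (k : κ) (w : (T (k : ι)).toSubmodule), (γ : Module.End ℚ V) w = 0 := fun k w => by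
    rw [← hr γ k w, hγ, Pi.zero_apply, ZeroMemClass.coe_zero, LinearMap.zero_apply, Submodule.coe_zero]
  -- hence every block (`Tᵢ ≅ T_{c i}` and `γ` commutes with the isomorphism), hence `V`
  apply hinj₀
  rw [map_zero]
  refine funext fun i => Subtype.ext (LinearMap.ext fun v => Subtype.ext ?_)
  rw [hr₀, Pi.zero_apply, ZeroMemClass.coe_zero, LinearMap.zero_apply, Submodule.coe_zero]
  obtain ⟨g, hg⟩ := hc i
  have h1 := coe_hom_apply_eq_of_mem_centralizer_endAlg T hT γ.2 g v
  rw [hzero (c i)] at h1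
  have h2 : g.toLinearMap ⟨(γ : Module.End ℚ V) v, apply_mem_of_mem_centralizer_endAlg T hT γ.2 i v.2⟩ = 0 := by
    rw [← Submodule.coe_eq_zero]
    exact h1.symm
  have h3 : (⟨(γ : Module.End ℚ V) v, apply_mem_of_mem_centralizer_endAlg T hT γ.2 i v.2⟩ : (T i).toSubmodule) = 0 :=
    hg.1 (by rw [h2, map_zero])
  exact congrArg Subtype.val h3

include hκ

variable [Module.Finite ℚ V]

/-- **MILNE'S PROPOSITION 1.1, CANONICAL FORM: restriction to the representatives is an isomorphism of `ℚ`-algebras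
`C(H) ≃ₐ[ℚ] Π_{k ∈ κ} C(T_k)`, `(e γ)_k v = γ v`**, for every isotypically labelled irreducible decomposition `V = ⊕ᵢ Tᵢ` of a
finite-dimensional `ℚ`-Hodge structure («any such isogeny induces an isomorphism `C(A₁) × ⋯ × C(A_s) → C(A)` … independent of
the choice of the isogeny»: injective by `exists_algHom_pi_centralizer_of_labelling`, surjective because both sides have dimension
`Σ_k dim C(T_k)`, g52-#5). [cite: Milne1999LefschetzClasses, §1 Prop. 1.1 (p. 643)] [cite: Lange2023AbelianVarietiesComplex, §2.4.4 Cor. 2.4.26 (p. 124)] -/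
theorem exists_algEquiv_pi_centralizer_of_labelling (hirr : ∀ i, (T i).toHodgeStructure.IsIrreducible) :
    ∃ e : Subalgebra.centralizer ℚ (H.endAlg : Set (Module.End ℚ V)) ≃ₐ[ℚ]
        Π k : κ, Subalgebra.centralizer ℚ (((T k).toHodgeStructure).endAlg : Set (Module.End ℚ (T k).toSubmodule)),
      ∀ (γ : Subalgebra.centralizer ℚ (H.endAlg : Set (Module.End ℚ V))) (k : κ) (v : (T k).toSubmodule),
        ((e γ k : Module.End ℚ (T k).toSubmodule) v : V) = (γ : Module.End ℚ V) v := by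
  obtain ⟨r, hr, hinj⟩ := exists_algHom_pi_centralizer_of_labelling T hT hc
  haveI : Module.Finite ℚ (Subalgebra.centralizer ℚ (H.endAlg : Set (Module.End ℚ V))) :=
    Module.Finite.of_injective (Subalgebra.val _).toLinearMap Subtype.val_injective
  haveI : ∀ k : κ, Module.Finite ℚ
      (Subalgebra.centralizer ℚ (((T k).toHodgeStructure).endAlg : Set (Module.End ℚ (T k).toSubmodule))) := fun k =>
    Module.Finite.of_injective (Subalgebra.val _).toLinearMap Subtype.val_injective
  haveI : ∀ k : κ, Module.Free ℚ
      (Subalgebra.centralizer ℚ (((T k).toHodgeStructure).endAlg : Set (Module.End ℚ (T k).toSubmodule))) := fun k => by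
    exact Module.Free.of_divisionRing ℚ
      (Subalgebra.centralizer ℚ (((T k).toHodgeStructure).endAlg : Set (Module.End ℚ (T k).toSubmodule)))
  have hdim : Module.finrank ℚ (Subalgebra.centralizer ℚ (H.endAlg : Set (Module.End ℚ V))) =
      Module.finrank ℚ (Π k : κ, Subalgebra.centralizer ℚ
        (((T k).toHodgeStructure).endAlg : Set (Module.End ℚ (T k).toSubmodule))) := by
    rw [finrank_centralizer_endAlg_eq_sum_of_labelling T hT hc hκ hirr, Module.finrank_pi_fintype]
  -- the restriction map read as a `ℚ`-linear map between finite-dimensional spaces of equal dimension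
  let rL : Subalgebra.centralizer ℚ (H.endAlg : Set (Module.End ℚ V)) →ₗ[ℚ]
      Π k : κ, Subalgebra.centralizer ℚ (((T k).toHodgeStructure).endAlg : Set (Module.End ℚ (T k).toSubmodule)) :=
    r.toLinearMap
  -- (the carriers are given explicitly so that the instances are synthesized before unification)
  have key := @LinearMap.injective_iff_surjective_of_finrank_eq_finrank ℚ
    (Subalgebra.centralizer ℚ (H.endAlg : Set (Module.End ℚ V))) _ _ _
    (Π k : κ, Subalgebra.centralizer ℚ (((T k).toHodgeStructure).endAlg : Set (Module.End ℚ (T k).toSubmodule)))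
    _ _ _ _ hdim rL
  have hsurj : Function.Surjective r := key.1 hinj
  exact ⟨AlgEquiv.ofBijective r ⟨hinj, hsurj⟩, hr⟩

/-- **MILNE'S PROPOSITION 1.1 «of `k`-algebras with involution», canonical form**: for EVERY polarization `ψ` of `H` the
restriction isomorphism `e : C(H) ≃ₐ[ℚ] Π_{k ∈ κ} C(T_k)` satisfies `(e γ†)_k = (e γ)_k^{†_k}`, `†` the adjoint of `ψ` (which preserves
`C(H)`), `†_k` that of `ψ|_{T_k}` (g52-#3 `Polarization.coe_apply_centralizer_adjoint_eq`: ANY map over the restrictions does).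
[cite: Milne1999LefschetzClasses, §1 Prop. 1.1 (p. 643)] [cite: Huybrechts2016K3, §3.3.5 eq. (3.3)] -/
theorem Polarization.exists_algEquiv_pi_centralizer_coe_apply_eq_adjoint_of_labelling (ψ : Polarization H)
    (hirr : ∀ i, (T i).toHodgeStructure.IsIrreducible) :
    ∃ e : Subalgebra.centralizer ℚ (H.endAlg : Set (Module.End ℚ V)) ≃ₐ[ℚ]
        Π k : κ, Subalgebra.centralizer ℚ (((T k).toHodgeStructure).endAlg : Set (Module.End ℚ (T k).toSubmodule)),
      (∀ (γ : Subalgebra.centralizer ℚ (H.endAlg : Set (Module.End ℚ V))) (k : κ) (v : (T k).toSubmodule),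
        ((e γ k : Module.End ℚ (T k).toSubmodule) v : V) = (γ : Module.End ℚ V) v) ∧
      ∀ (γ : Subalgebra.centralizer ℚ (H.endAlg : Set (Module.End ℚ V))) (k : κ),
        ((e ⟨ψ.adjoint γ, ψ.adjoint_mem_centralizer_endAlg γ.2⟩ k) : Module.End ℚ (T k).toSubmodule) =
          (ψ.restrict (T k)).adjoint (e γ k) := by
  obtain ⟨e, he⟩ := exists_algEquiv_pi_centralizer_of_labelling T hT hc hκ hirr
  exact ⟨e, he, fun γ k => ψ.coe_apply_centralizer_adjoint_eq (fun k : κ => T k) e he γ k⟩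

/-- **`γ ∈ C(H)` is determined by its restrictions to the representatives, and every family `(δ_k)_k`, `δ_k ∈ C(T_k)`, is the
family of restrictions of a unique `γ ∈ C(H)`** (bijectivity of restriction, spelled out). [cite: Milne1999LefschetzClasses, §1 Prop. 1.1 (p. 643)] -/
theorem existsUnique_mem_centralizer_forall_coe_apply_eq (hirr : ∀ i, (T i).toHodgeStructure.IsIrreducible)
    (δ : Π k : κ, Subalgebra.centralizer ℚ (((T k).toHodgeStructure).endAlg : Set (Module.End ℚ (T k).toSubmodule))) :
    ∃! γ : Module.End ℚ V, γ ∈ Subalgebra.centralizer ℚ (H.endAlg : Set (Module.End ℚ V)) ∧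
      ∀ (k : κ) (v : (T k).toSubmodule), γ v = ((δ k : Module.End ℚ (T k).toSubmodule) v : V) := by
  obtain ⟨e, he⟩ := exists_algEquiv_pi_centralizer_of_labelling T hT hc hκ hirr
  refine ⟨(e.symm δ : Subalgebra.centralizer ℚ (H.endAlg : Set (Module.End ℚ V))), ⟨(e.symm δ).2, fun k v =>
    coe_symm_apply_eq_of_forall_coe_apply_eq T e he δ k v⟩, fun γ' hγ' => ?_⟩
  obtain ⟨hγ'C, hγ'⟩ := hγ'
  have h : e ⟨γ', hγ'C⟩ = δ :=
    funext fun k => Subtype.ext (LinearMap.ext fun v => Subtype.ext ((he ⟨γ', hγ'C⟩ k v).trans (hγ' k v)))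
  have h' : (⟨γ', hγ'C⟩ : Subalgebra.centralizer ℚ (H.endAlg : Set (Module.End ℚ V))) = e.symm δ := by
    rw [← h, AlgEquiv.symm_apply_apply]
  exact congrArg Subtype.val h'

end Labelled

end HodgeStructure

end Literature.AlgebraicGeometry.Motives
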